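import Summits.HubbardSuperconductivity.HubbardSuperconductivity.Theses.PolyaSchurPairBoson
import Summits.AtomisticToContinuum.BoseEinsteinCondensation.Theorems.BECStronglyRayleighStableImpliesPairCoherence

/-!
# Route `PolyaSchurPairBoson`, support `StableImpliesPairCoherence` (stmt-HubbardSuperconductivity-10292)

From zero-freeness of the generating polynomial of a nonnegative `φ` supported on `N`-sets
(`N ≥ 2`) to the pair-insertion coherence inequality
`N(N−1) Σ_S φ(S)² ≤ Σ_{|T|=N−2} [(Σ_x (r^T_x)³)/(Σ_x r^T_x) + (Σ_x (r^T_x)²)²/(Σ_x r^T_x)²]`. The item is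
stated VERBATIM as the BEC route's support `stmt-AtomisticToContinuum-9675`
(`BECStronglyRayleigh.StableImpliesPairCoherence`), proved in the tree
(`Summit.AtomisticToContinuum.BoseEinsteinCondensation.Theorems.StableImpliesPairCoherence_proof`,
`Theorems/BECStronglyRayleighStableImpliesPairCoherence.lean`); the propositions are syntactically
equal (`Iff.rfl`), so the proof transfers.

Sources: P. Brändén, J. Huh, Ann. Math. 192 (2020) 821 (Lorentzian polynomials); the BEC route's
landed proof. No definition is introduced.
-/

set_option linter.dupNamespace false

namespace Summit.HubbardSuperconductivity.HubbardSuperconductivity.Theorems.PolyaSchurPairBoson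

open Summit.HubbardSuperconductivity.HubbardSuperconductivity.Theses.PolyaSchurPairBoson

/-- The Hubbard-route item and the BEC-route item are one proposition. [folklore] -/
theorem stableImpliesPairCoherence_iff_bec :
    StableImpliesPairCoherence ↔
      Summit.AtomisticToContinuum.BoseEinsteinCondensation.Theses.BECStronglyRayleigh.StableImpliesPairCoherence :=
  Iff.rfl

/-- **`StableImpliesPairCoherence` holds** (route `PolyaSchurPairBoson`, item
`stmt-HubbardSuperconductivity-10292`): transferred from the landed BEC-route theorem
`StableImpliesPairCoherence_proof`. Brändén–Huh, Ann. Math. 192 (2020) 821. [folklore] -/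
theorem stableImpliesPairCoherence_proof : StableImpliesPairCoherence :=
  stableImpliesPairCoherence_iff_bec.mpr
    Summit.AtomisticToContinuum.BoseEinsteinCondensation.Theorems.StableImpliesPairCoherence_proof

end Summit.HubbardSuperconductivity.HubbardSuperconductivity.Theorems.PolyaSchurPairBoson
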